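import Summits.HodgeConjecture.HodgeConjecture.Theorems.F0P3bPNullGeneration
import Summits.HodgeConjecture.HodgeConjecture.Theorems.F0P3bGKPairGlue
import Literature.NumberTheory.Automorphic.GKModules
import Mathlib.RepresentationTheory.Basic
import HarnessLib

/-!
# FLOOR-0 P3b «ENGINE local packets» — stub T6r `stub_T6r_pNullRigidity` of `Lines/F0_EngineLocalPackets.lean`, PROVED:
# rigidity of an irreducible `(𝔤, K)`-module of `U(α, β)` from the real kernel of a `𝔭^{−δ}`-null type-`δ` cochain

Cell hodgecm-mathlib, FLOOR 0, crux item H413 = stmt-HodgeConjecture-24833; sub-line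
`Cruxes/H413/Lines/F0_EngineLocalPackets.lean` edition 2 ∕ 2.1 (843c62f29c241097 ∕ ccfbad029bef5c0a), registered stub **T6r**
`stub_T6r_pNullRigidity : StubT6rPNullRigidity` (ed. 2.1 :337–355).  PROOF lane (theorems only, no `def`); author F0P3-p03 (g2).
Per the cell's stub-closer protocol the Lines module is NOT imported: the closing theorem `stubT6r_holds` has as TYPE the body
of `…Cruxes.H413.F0EngineLocalPackets.StubT6rPNullRigidity` BINDER FOR BINDER with the Lines-local predicate `IsPNull ρ𝔤 δ v`
replaced by its `def` body (`∀ s, ⁅x_s, v⁆ + (δ i) • ⁅⁅z₀, x_s⁆, v⁆ = 0`), so that the registrar's fold is the one-liner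
`theorem stub_T6r_pNullRigidity : StubT6rPNullRigidity := F0P3bStubT6rPNullRigidity.stubT6r_holds` (definitional unfolding,
as for ★ T3j).

THE STATEMENT.  Two IRREDUCIBLE `(𝔤, K)`-modules `V`, `V′` of `U(α, β)` (only `Ad`-compatibility `hV`, `hV′` and
`IsIrreducibleGK` — no admissibility, unitarity or `K`-finiteness) carrying NON-ZERO `(𝔤, K)`-1-cochains `f`, `f′` of the same
type `δ = ±1` whose values are `𝔭^{−δ}`-null, WITH THE SAME REAL KERNEL `{X | f(X) = 0} = {X | f′(X) = 0}`, are
`(𝔤, K)`-equivalent (`AreGKEquivalent`).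

THE ARGUMENT (the graph-submodule ∕ Goursat form of [BorelWallach2000, VI Thm. 4.11 (1)]; [KnappVogan1995, Cor. 2.78];
[VoganZuckerman1984, Thm. 5.6] — uniqueness of the irreducible module generated by its lowest `K`-type, without Verma modules).
* glue (★ `F0P3bStubT6kU21PGeometry` §1, F0P3-p04 (g2), and `F0P3bGKPairGlue`): a `(𝔤, K)`-1-cochain is `𝔨`-equivariant,
  horizontal, `K`-equivariant (`ρK(k) f(X) = f(Ad k X)`), additive and `ℝ`-homogeneous in `X`; type `δ` gives
  `f(⁅z₀, X⁆) = δ i · f(X)`, so for `δ² = 1` EVERY complex multiple `c · f(X)` is again a value `f(Z)`,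
  `Z = (Re c) X + δ (Im c) ⁅z₀, X⁆` — a formula for `Z` that does not depend on `f` (`typeOne_smul_apply_eq`); images of
  `(𝔤, K)`-submodules under equivariant linear maps and intersections with their kernels are `(𝔤, K)`-submodules.
* §2 generic: in ANY pair datum, a vector of the generated subspace `gen μ E` (★ `F0P3bPNullGeneration`, F0P3-p01 (g2)) of a core
  `E` of `z₀`-weight `w` which itself has `z₀`-weight `w` lies in `E` (independence of the `z₀`-eigenspaces; `μ ≠ 0`).
* §3 the stub: `E := span_ℂ {(f X, f′ X)} ⊆ V × V′` consists EXACTLY of the pairs `(f Z, f′ Z)` (§1), is a null core (null,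
  `𝔨`-stable, `K`-stable, `z₀`-weight `δ i`) for the product pair datum `(ρK.prod ρK′, ρ𝔤 ⊕ ρ𝔤′)`, and meets `0 × V′` and
  `V × 0` trivially (equal kernels).  `D := gen (δ i) E` is a `(𝔤, K)`-submodule of `V × V′` (★ `isGKSubmodule_gen`) inside
  `⨆_n eigenspace(z₀, δ(n+1) i)`.  Its two projections are non-zero `(𝔤, K)`-submodules of the irreducible factors, hence onto;
  the kernel of `D → V` projects to a `(𝔤, K)`-submodule `U′` of `V′`, and `U′ = V′` would put `(0, f′(Y))` (`f′(Y) ≠ 0`,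
  weight `δ i`) in `D ∩ eigenspace(δ i) = E`, i.e. `(0, f′ Y) = (f Z, f′ Z)` with `f Z = 0`, so `f′ Z = 0 = f′ Y` —
  contradiction; so both projections are bijective and `V ≃ D ≃ V′` is a `GKEquiv`.  (No «`z₀`-stable subspace is graded» step is
  needed.)

References: A. Borel, N. Wallach, *Continuous cohomology, discrete subgroups, and representations of reductive groups*, 2nd ed.,
AMS 2000, II §4.1–4.2, VI Thm. 4.11 [BorelWallach2000]; A. Knapp, D. Vogan, *Cohomological induction and unitary representations*,
Princeton 1995, §II.4 Cor. 2.78 [KnappVogan1995]; D. Vogan, G. Zuckerman, Unitary representations with non-zero cohomology,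
Compositio Math. 53 (1984), Thm. 5.6 [VoganZuckerman1984]; J. Rogawski, *Automorphic representations of unitary groups in three
variables*, Princeton 1990, §15.2 [Rogawski1990].

HONEST LABEL: HC_CM is proved only modulo the printed citations until rung 0 closes; this file discharges none of them.
-/

-- Mathlib idiom (as in `GKModules`, `GKCohomology`, the `Upq*` files and the Lines file): commutator bracket on `Module.End`
attribute [local instance 100] LieRing.ofAssociativeRing

set_option autoImplicit false
set_option linter.dupNamespace false

noncomputable section

namespace Summit.HodgeConjecture.HodgeConjecture.Cruxes.H413.F0P3bStubT6rPNullRigidity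

open Literature.Algebra.Lie Literature.Algebra.Lie.ChevalleyEilenberg
open Literature.NumberTheory.Automorphic
open Literature.RepresentationTheory.BorelWallach2000
open Literature.RepresentationTheory.KonnoKonno2007 Literature.RepresentationTheory.KonnoKonno2007.RealDualPair
open Literature.RepresentationTheory.KonnoKonno2007.RealDualPair.UForm
open Summit.HodgeConjecture.HodgeConjecture.Cruxes.H413.F0P3bPPartOperators
open Summit.HodgeConjecture.HodgeConjecture.Cruxes.H413.F0P3bPNullGeneration
open Summit.HodgeConjecture.HodgeConjecture.Cruxes.H413.F0P3bStubT6kU21PGeometry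
open Summit.HodgeConjecture.HodgeConjecture.Cruxes.H413.F0P3bGKPairGlue

variable {α β : Type} [Fintype α] [DecidableEq α] [Fintype β] [DecidableEq β]

/-! ## §2 Weight-`w` vectors of the subspace generated by a core of weight `w` (any pair datum) -/

section Generic

variable {P : Type} [AddCommGroup P] [Module ℂ P]
  (σ𝔤 : (uFormGroup α β).lie →ₗ⁅ℝ⁆ Module.End ℂ P)

/-- **A weight-`w` vector of the subspace generated by a core of weight `w` lies in the core**: `gen μ E ⊓
eigenspace(ρz₀, w) ≤ E` (`G_n ⊆ eigenspace(w + nμ)`, `μ ≠ 0`, independence of eigenspaces).  The irreducible case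
`eigenspace(w) = E` is p01's `eigenspace_eq_of_isNullCore`; here no irreducibility. [cite: BorelWallach2000, II §4.1] -/
theorem mem_core_of_mem_gen_of_z0_apply {μ : ℂ} (hμ : μ * μ = -1) {E : Submodule ℂ P} {w : ℂ}
    (hw : ∀ e ∈ E, σ𝔤 (upqZ0 α β) e = w • e) {v : P} (hv : v ∈ gen σ𝔤 μ E)
    (hvw : σ𝔤 (upqZ0 α β) v = w • v) : v ∈ E := by
  have hμ0 : μ ≠ 0 := fun h => by rw [h, mul_zero] at hμ; exact one_ne_zero (neg_eq_zero.1 hμ.symm)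
  rw [gen, iSup_split_single _ 0, Submodule.mem_sup] at hv
  obtain ⟨e, he, r, hr, rfl⟩ := hv
  rw [grade_zero] at he
  have hr' : r ∈ ⨆ (θ' : ℂ) (_ : θ' ≠ w), Module.End.eigenspace (σ𝔤 (upqZ0 α β)) θ' := by
    have hsub : (⨆ (n : ℕ) (_ : n ≠ 0), grade σ𝔤 μ E n) ≤
        ⨆ (θ' : ℂ) (_ : θ' ≠ w), Module.End.eigenspace (σ𝔤 (upqZ0 α β)) θ' := by
      refine iSup₂_le fun n hn => ?_
      refine le_iSup₂_of_le (f := fun θ' (_ : θ' ≠ w) => Module.End.eigenspace (σ𝔤 (upqZ0 α β)) θ') (w + n * μ)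
        ?_ (grade_le_eigenspace hμ hw n)
      intro h
      have : (n : ℂ) * μ = 0 := by
        have h' := h
        nth_rw 2 [← add_zero w] at h'
        exact add_left_cancel h'
      rcases mul_eq_zero.1 this with h1 | h1
      · exact hn (by exact_mod_cast h1)
      · exact hμ0 h1
    exact hsub hr
  have hrw : r ∈ Module.End.eigenspace (σ𝔤 (upqZ0 α β)) w := by
    have := Submodule.sub_mem _ (Module.End.mem_eigenspace_iff.2 hvw) (Module.End.mem_eigenspace_iff.2 (hw e he))
    rwa [add_sub_cancel_left] at this
  have hr0 : r = 0 := by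
    have h := ((Module.End.eigenspaces_iSupIndep (σ𝔤 (upqZ0 α β))) w).le_bot (Submodule.mem_inf.2 ⟨hrw, hr'⟩)
    rwa [Submodule.mem_bot] at h
  rw [hr0, add_zero]
  exact he

end Generic

/-! ## §3 The registered stub T6r of `Lines/F0_EngineLocalPackets.lean` (edition 2) -/

/-- **Stub T6r of `Lines/F0_EngineLocalPackets.lean` (edition 2), proved** — body of `StubT6rPNullRigidity` binder for binder,
with the Lines-local `IsPNull ρ𝔤 δ (f Y)` unfolded: two irreducible `(𝔤, K)`-modules of `U(α, β)` carrying non-zero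
`𝔭^{−δ}`-null `(𝔤, K)`-1-cochains of the same type `δ = ±1` with the same real kernel are `(𝔤, K)`-equivalent (graph
submodule generated by `{(f Z, f′ Z)}`; both projections bijective).
[cite: BorelWallach2000, VI Thm. 4.11 (1); KnappVogan1995, Cor. 2.78; VoganZuckerman1984, Thm. 5.6] -/
theorem stubT6r_holds :
    ∀ (α β : Type) [Fintype α] [DecidableEq α] [Fintype β] [DecidableEq β]
      (V : Type) [AddCommGroup V] [Module ℂ V]
      (ρK : Representation ℂ (uFormGroup α β).maximalCompact V) (ρ𝔤 : (uFormGroup α β).lie →ₗ⁅ℝ⁆ Module.End ℂ V)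
      (hV : ∀ (k : (uFormGroup α β).maximalCompact) (X : (uFormGroup α β).lie), ρK k ∘ₗ ρ𝔤 X ∘ₗ ρK k⁻¹ =
        ρ𝔤 ((uFormGroup α β).Ad (Subgroup.inclusion (uFormGroup α β).maximalCompact_le_carrier k) X))
      (V' : Type) [AddCommGroup V'] [Module ℂ V']
      (ρK' : Representation ℂ (uFormGroup α β).maximalCompact V') (ρ𝔤' : (uFormGroup α β).lie →ₗ⁅ℝ⁆ Module.End ℂ V')
      (hV' : ∀ (k : (uFormGroup α β).maximalCompact) (X : (uFormGroup α β).lie), ρK' k ∘ₗ ρ𝔤' X ∘ₗ ρK' k⁻¹ =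
        ρ𝔤' ((uFormGroup α β).Ad (Subgroup.inclusion (uFormGroup α β).maximalCompact_le_carrier k) X)),
      IsIrreducibleGK ρK ρ𝔤 → IsIrreducibleGK ρK' ρ𝔤' →
      ∀ (δ : ℤ), δ = 1 ∨ δ = -1 →
      ∀ (f : Cochain ℝ (uFormGroup α β).lie (GKCarrier (uFormGroup α β) ρ𝔤) 1)
        (f' : Cochain ℝ (uFormGroup α β).lie (GKCarrier (uFormGroup α β) ρ𝔤') 1),
        f ∈ upqType ρK ρ𝔤 hV 1 δ → f' ∈ upqType ρK' ρ𝔤' hV' 1 δ → f ≠ 0 → f' ≠ 0 →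
        (∀ Y : Fin 1 → (uFormGroup α β).lie,
          ∀ s : (α × β) × Fin 2, ⁅upqPBasis s, f Y⁆ + ((δ : ℂ) * Complex.I) • ⁅⁅upqZ0 α β, upqPBasis s⁆, f Y⁆ = 0) →
        (∀ Y : Fin 1 → (uFormGroup α β).lie,
          ∀ s : (α × β) × Fin 2, ⁅upqPBasis s, f' Y⁆ + ((δ : ℂ) * Complex.I) • ⁅⁅upqZ0 α β, upqPBasis s⁆, f' Y⁆ = 0) →
        (∀ X : (uFormGroup α β).lie, f ![X] = 0 ↔ f' ![X] = 0) →
        AreGKEquivalent ρK ρ𝔤 ρK' ρ𝔤' := by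
  intro α β _ _ _ _ V _ _ ρK ρ𝔤 hV V' _ _ ρK' ρ𝔤' hV' hirr hirr' δ hδ f f' hf hf' hf0 hf'0 hfN hf'N hker
  -- §3.0 scalars
  have hδ1 : δ * δ = 1 := by rcases hδ with rfl | rfl <;> norm_num
  set μ : ℂ := (δ : ℂ) * Complex.I with hμdef
  have hμ : μ * μ = -1 := by
    have hδC : (δ : ℂ) * (δ : ℂ) = 1 := by exact_mod_cast hδ1
    rw [hμdef, mul_mul_mul_comm, hδC, Complex.I_mul_I, one_mul]
  obtain ⟨hfc, hft⟩ := (mem_upqType_iff ρK ρ𝔤 hV 1 δ f).1 hf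
  obtain ⟨hf'c, hf't⟩ := (mem_upqType_iff ρK' ρ𝔤' hV' 1 δ f').1 hf'
  -- §3.1 the product pair datum on `P = V × V'`
  let σK : Representation ℂ (uFormGroup α β).maximalCompact (V × V') := ρK.prod ρK'
  let σ𝔤 : (uFormGroup α β).lie →ₗ⁅ℝ⁆ Module.End ℂ (V × V') :=
    { toFun := fun X => (ρ𝔤 X).prodMap (ρ𝔤' X)
      map_add' := fun X Y => by
        rw [map_add, map_add, LinearMap.prodMap_add]
      map_smul' := fun r X => by
        refine LinearMap.ext fun p => Prod.ext ?_ ?_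
        · change ρ𝔤 (r • X) p.1 = ((r • ((ρ𝔤 X).prodMap (ρ𝔤' X))) p).1
          rw [map_smul, LinearMap.smul_apply, LinearMap.smul_apply, LinearMap.prodMap_apply, Prod.smul_fst]
        · change ρ𝔤' (r • X) p.2 = ((r • ((ρ𝔤 X).prodMap (ρ𝔤' X))) p).2
          rw [map_smul, LinearMap.smul_apply, LinearMap.smul_apply, LinearMap.prodMap_apply, Prod.smul_snd]
      map_lie' := fun {X Y} => by
        refine LinearMap.ext fun p => Prod.ext ?_ ?_
        · change ρ𝔤 ⁅X, Y⁆ p.1 = (⁅(ρ𝔤 X).prodMap (ρ𝔤' X), (ρ𝔤 Y).prodMap (ρ𝔤' Y)⁆ p).1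
          simp only [LieHom.map_lie, Ring.lie_def, LinearMap.sub_apply, Prod.fst_sub, Module.End.mul_apply,
            LinearMap.prodMap_apply]
        · change ρ𝔤' ⁅X, Y⁆ p.2 = (⁅(ρ𝔤 X).prodMap (ρ𝔤' X), (ρ𝔤 Y).prodMap (ρ𝔤' Y)⁆ p).2
          simp only [LieHom.map_lie, Ring.lie_def, LinearMap.sub_apply, Prod.snd_sub, Module.End.mul_apply,
            LinearMap.prodMap_apply] }
  have hσ𝔤 : ∀ (X : (uFormGroup α β).lie) (p : V × V'), σ𝔤 X p = (ρ𝔤 X p.1, ρ𝔤' X p.2) := fun X p => rfl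
  have hσK : ∀ (k : (uFormGroup α β).maximalCompact) (p : V × V'), σK k p = (ρK k p.1, ρK' k p.2) := fun k p => rfl
  have hP : ∀ (k : (uFormGroup α β).maximalCompact) (X : (uFormGroup α β).lie), σK k ∘ₗ σ𝔤 X ∘ₗ σK k⁻¹ =
      σ𝔤 ((uFormGroup α β).Ad (Subgroup.inclusion (uFormGroup α β).maximalCompact_le_carrier k) X) := by
    intro k X
    refine LinearMap.ext fun p => ?_
    rw [LinearMap.comp_apply, LinearMap.comp_apply, hσK, hσ𝔤, hσK, hσ𝔤]
    exact Prod.ext (LinearMap.congr_fun (hV k X) p.1) (LinearMap.congr_fun (hV' k X) p.2)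
  have hfst_K : ∀ (k : (uFormGroup α β).maximalCompact) (p : V × V'), LinearMap.fst ℂ V V' (σK k p) = ρK k (LinearMap.fst ℂ V V' p) :=
    fun k p => by rw [hσK, LinearMap.fst_apply, LinearMap.fst_apply]
  have hfst_𝔤 : ∀ (X : (uFormGroup α β).lie) (p : V × V'), LinearMap.fst ℂ V V' (σ𝔤 X p) = ρ𝔤 X (LinearMap.fst ℂ V V' p) :=
    fun X p => by rw [hσ𝔤, LinearMap.fst_apply, LinearMap.fst_apply]
  have hsnd_K : ∀ (k : (uFormGroup α β).maximalCompact) (p : V × V'), LinearMap.snd ℂ V V' (σK k p) = ρK' k (LinearMap.snd ℂ V V' p) :=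
    fun k p => by rw [hσK, LinearMap.snd_apply, LinearMap.snd_apply]
  have hsnd_𝔤 : ∀ (X : (uFormGroup α β).lie) (p : V × V'), LinearMap.snd ℂ V V' (σ𝔤 X p) = ρ𝔤' X (LinearMap.snd ℂ V V' p) :=
    fun X p => by rw [hσ𝔤, LinearMap.snd_apply, LinearMap.snd_apply]
  -- §3.2 the core `E = {(f Z, f' Z)}`
  let gph : (uFormGroup α β).lie → V × V' := fun X => ((f ![X] : V), (f' ![X] : V'))
  let E : Submodule ℂ (V × V') := Submodule.span ℂ (Set.range gph)
  have hgph_mem : ∀ X, gph X ∈ E := fun X => Submodule.subset_span ⟨X, rfl⟩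
  have hE_iff : ∀ p : V × V', p ∈ E ↔ ∃ X, p = gph X := by
    intro p
    refine ⟨fun hp => ?_, ?_⟩
    · refine Submodule.span_induction (p := fun q _ => ∃ X, q = gph X) ?_ ?_ ?_ ?_ hp
      · rintro q ⟨X, rfl⟩; exact ⟨X, rfl⟩
      · exact ⟨0, Prod.ext (cochainOne_apply_zero ρ𝔤 f).symm (cochainOne_apply_zero ρ𝔤' f').symm⟩
      · rintro q q' - - ⟨X, rfl⟩ ⟨X', rfl⟩
        exact ⟨X + X', Prod.ext (cochainOne_apply_add ρ𝔤 f X X').symm (cochainOne_apply_add ρ𝔤' f' X X').symm⟩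
      · rintro c q - ⟨X, rfl⟩
        exact ⟨c.re • X + ((δ : ℝ) * c.im) • ⁅upqZ0 α β, X⁆, Prod.ext (typeOne_smul_apply_eq ρK ρ𝔤 hV hδ1 hf c X)
          (typeOne_smul_apply_eq ρK' ρ𝔤' hV' hδ1 hf' c X)⟩
    · rintro ⟨X, rfl⟩; exact hgph_mem X
  -- the three null-core properties and the weight
  have hEn : ∀ e ∈ E, ∀ s : (α × β) × Fin 2, pOp σ𝔤 μ (upqPBasis s) e = 0 := by
    intro e he s
    obtain ⟨X, rfl⟩ := (hE_iff e).1 he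
    have h1 : pOp ρ𝔤 μ (upqPBasis s) (f ![X] : V) = 0 := hfN ![X] s
    have h2 : pOp ρ𝔤' μ (upqPBasis s) (f' ![X] : V') = 0 := hf'N ![X] s
    rw [pOp_apply] at h1 h2 ⊢
    rw [hσ𝔤, hσ𝔤]
    exact Prod.ext h1 h2
  have hEk : ∀ W ∈ (uFormGroup α β).kInLie, ∀ e ∈ E, σ𝔤 W e ∈ E := by
    intro W hW e he
    obtain ⟨X, rfl⟩ := (hE_iff e).1 he
    rw [hσ𝔤]
    change (ρ𝔤 W (f ![X] : V), ρ𝔤' W (f' ![X] : V')) ∈ E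
    rw [lie_apply_of_mem_kInLie ρK ρ𝔤 hV hfc hW X, lie_apply_of_mem_kInLie ρK' ρ𝔤' hV' hf'c hW X]
    exact hgph_mem ⁅W, X⁆
  have hEK : ∀ (k : (uFormGroup α β).maximalCompact), ∀ e ∈ E, σK k e ∈ E := by
    intro k e he
    obtain ⟨X, rfl⟩ := (hE_iff e).1 he
    rw [hσK]
    change (ρK k (f ![X] : V), ρK' k (f' ![X] : V')) ∈ E
    rw [gkOne_K_apply ρK ρ𝔤 hV hfc k X, gkOne_K_apply ρK' ρ𝔤' hV' hf'c k X]
    exact hgph_mem _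
  have hw : ∀ e ∈ E, σ𝔤 (upqZ0 α β) e = μ • e := by
    intro e he
    obtain ⟨X, rfl⟩ := (hE_iff e).1 he
    rw [hσ𝔤]
    exact Prod.ext (hft ![X]) (hf't ![X])
  -- the core meets `0 × V'` and `V × 0` trivially (equal kernels)
  have hE_fst : ∀ e ∈ E, e.1 = 0 → e = 0 := by
    intro e he h1
    obtain ⟨X, rfl⟩ := (hE_iff e).1 he
    have h2 : f' ![X] = 0 := (hker X).1 h1
    exact Prod.ext h1 h2
  have hE_snd : ∀ e ∈ E, e.2 = 0 → e = 0 := by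
    intro e he h2
    obtain ⟨X, rfl⟩ := (hE_iff e).1 he
    have h1 : f ![X] = 0 := (hker X).2 h2
    exact Prod.ext h1 h2
  -- §3.3 the generated `(𝔤, K)`-submodule `D` and its projections
  set D : Submodule ℂ (V × V') := gen σ𝔤 μ E with hDdef
  have hD : IsGKSubmodule σK σ𝔤 D := isGKSubmodule_gen hP hEn hEk hEK
  have hED : E ≤ D := le_gen μ E
  obtain ⟨X₀, hX₀⟩ := cochainOne_exists_apply_ne_zero ρ𝔤 hf0
  obtain ⟨X₁, hX₁⟩ := cochainOne_exists_apply_ne_zero ρ𝔤' hf'0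
  -- weight-`μ` vectors of `D` lie in `E`
  have hDμ : ∀ p ∈ D, σ𝔤 (upqZ0 α β) p = μ • p → p ∈ E := fun p hp hpμ =>
    mem_core_of_mem_gen_of_z0_apply σ𝔤 hμ hw hp hpμ
  -- surjectivity of the projections (irreducibility of the factors)
  have hsurj₁ : D.map (LinearMap.fst ℂ V V') = ⊤ := by
    rcases hirr.eq_bot_or_eq_top (isGKSubmodule_map (LinearMap.fst ℂ V V') hfst_K hfst_𝔤 hD) with h | h
    · exfalso
      apply hX₀
      have : (gph X₀).1 ∈ D.map (LinearMap.fst ℂ V V') := Submodule.mem_map.2 ⟨gph X₀, hED (hgph_mem X₀), rfl⟩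
      rw [h, Submodule.mem_bot] at this
      exact this
    · exact h
  have hsurj₂ : D.map (LinearMap.snd ℂ V V') = ⊤ := by
    rcases hirr'.eq_bot_or_eq_top (isGKSubmodule_map (LinearMap.snd ℂ V V') hsnd_K hsnd_𝔤 hD) with h | h
    · exfalso
      apply hX₁
      have : (gph X₁).2 ∈ D.map (LinearMap.snd ℂ V V') := Submodule.mem_map.2 ⟨gph X₁, hED (hgph_mem X₁), rfl⟩
      rw [h, Submodule.mem_bot] at this
      exact this
    · exact h
  -- injectivity of the projections
  have hinj₁ : ∀ p ∈ D, p.1 = 0 → p = 0 := by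
    -- `U' = snd (D ⊓ ker fst)` is a `(𝔤, K)`-submodule of `V'`
    have hU : IsGKSubmodule ρK' ρ𝔤' ((D ⊓ LinearMap.ker (LinearMap.fst ℂ V V')).map (LinearMap.snd ℂ V V')) :=
      isGKSubmodule_map (LinearMap.snd ℂ V V') hsnd_K hsnd_𝔤 (isGKSubmodule_inf_ker (LinearMap.fst ℂ V V') hfst_K hfst_𝔤 hD)
    rcases hirr'.eq_bot_or_eq_top hU with h | h
    · intro p hp hp1
      have hp2 : p.2 ∈ (D ⊓ LinearMap.ker (LinearMap.fst ℂ V V')).map (LinearMap.snd ℂ V V') :=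
        Submodule.mem_map.2 ⟨p, Submodule.mem_inf.2 ⟨hp, hp1⟩, rfl⟩
      rw [h, Submodule.mem_bot] at hp2
      exact Prod.ext hp1 hp2
    · exfalso
      apply hX₁
      have hm : (gph X₁).2 ∈ (D ⊓ LinearMap.ker (LinearMap.fst ℂ V V')).map (LinearMap.snd ℂ V V') := by
        rw [h]; exact Submodule.mem_top
      obtain ⟨p, hp, hp2⟩ := Submodule.mem_map.1 hm
      obtain ⟨hpD, hp1⟩ := Submodule.mem_inf.1 hp
      rw [LinearMap.mem_ker, LinearMap.fst_apply] at hp1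
      rw [LinearMap.snd_apply] at hp2
      change p.2 = f' ![X₁] at hp2
      -- `p = (0, f' X₁)` has weight `μ`, hence lies in `E`
      have hpμ : σ𝔤 (upqZ0 α β) p = μ • p := by
        rw [hσ𝔤]
        refine Prod.ext ?_ ?_
        · rw [hp1, map_zero, Prod.smul_fst, hp1, smul_zero]
        · rw [hp2, Prod.smul_snd, hp2]; exact hf't ![X₁]
      have hpE : p ∈ E := hDμ p hpD hpμ
      have hp0 : p = 0 := hE_fst p hpE hp1
      rw [← hp2, hp0, Prod.snd_zero]
      rfl
  have hinj₂ : ∀ p ∈ D, p.2 = 0 → p = 0 := by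
    have hU : IsGKSubmodule ρK ρ𝔤 ((D ⊓ LinearMap.ker (LinearMap.snd ℂ V V')).map (LinearMap.fst ℂ V V')) :=
      isGKSubmodule_map (LinearMap.fst ℂ V V') hfst_K hfst_𝔤 (isGKSubmodule_inf_ker (LinearMap.snd ℂ V V') hsnd_K hsnd_𝔤 hD)
    rcases hirr.eq_bot_or_eq_top hU with h | h
    · intro p hp hp2
      have hp1 : p.1 ∈ (D ⊓ LinearMap.ker (LinearMap.snd ℂ V V')).map (LinearMap.fst ℂ V V') :=
        Submodule.mem_map.2 ⟨p, Submodule.mem_inf.2 ⟨hp, hp2⟩, rfl⟩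
      rw [h, Submodule.mem_bot] at hp1
      exact Prod.ext hp1 hp2
    · exfalso
      apply hX₀
      have hm : (gph X₀).1 ∈ (D ⊓ LinearMap.ker (LinearMap.snd ℂ V V')).map (LinearMap.fst ℂ V V') := by
        rw [h]; exact Submodule.mem_top
      obtain ⟨p, hp, hp1⟩ := Submodule.mem_map.1 hm
      obtain ⟨hpD, hp2⟩ := Submodule.mem_inf.1 hp
      rw [LinearMap.mem_ker, LinearMap.snd_apply] at hp2
      rw [LinearMap.fst_apply] at hp1
      change p.1 = f ![X₀] at hp1
      have hpμ : σ𝔤 (upqZ0 α β) p = μ • p := by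
        rw [hσ𝔤]
        refine Prod.ext ?_ ?_
        · rw [hp1, Prod.smul_fst, hp1]; exact hft ![X₀]
        · rw [hp2, map_zero, Prod.smul_snd, hp2, smul_zero]
      have hpE : p ∈ E := hDμ p hpD hpμ
      have hp0 : p = 0 := hE_snd p hpE hp2
      rw [← hp1, hp0, Prod.fst_zero]
      rfl
  -- §3.4 the two linear isomorphisms `D ≃ V`, `D ≃ V'` and the `GKEquiv`
  have hbij₁ : Function.Bijective (LinearMap.fst ℂ V V' ∘ₗ D.subtype) := by
    refine ⟨fun x y hxy => ?_, fun v => ?_⟩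
    · have h := hinj₁ (x.1 - y.1) (D.sub_mem x.2 y.2) (by
        rw [Prod.fst_sub, sub_eq_zero]; exact hxy)
      exact Subtype.ext (sub_eq_zero.1 h)
    · have hv : v ∈ D.map (LinearMap.fst ℂ V V') := by rw [hsurj₁]; exact Submodule.mem_top
      obtain ⟨p, hp, rfl⟩ := Submodule.mem_map.1 hv
      exact ⟨⟨p, hp⟩, rfl⟩
  have hbij₂ : Function.Bijective (LinearMap.snd ℂ V V' ∘ₗ D.subtype) := by
    refine ⟨fun x y hxy => ?_, fun v => ?_⟩
    · have h := hinj₂ (x.1 - y.1) (D.sub_mem x.2 y.2) (by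
        rw [Prod.snd_sub, sub_eq_zero]; exact hxy)
      exact Subtype.ext (sub_eq_zero.1 h)
    · have hv : v ∈ D.map (LinearMap.snd ℂ V V') := by rw [hsurj₂]; exact Submodule.mem_top
      obtain ⟨p, hp, rfl⟩ := Submodule.mem_map.1 hv
      exact ⟨⟨p, hp⟩, rfl⟩
  let e₁ : D ≃ₗ[ℂ] V := LinearEquiv.ofBijective _ hbij₁
  let e₂ : D ≃ₗ[ℂ] V' := LinearEquiv.ofBijective _ hbij₂
  have he₁ : ∀ d : D, e₁ d = (d : V × V').1 := fun d => rfl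
  have he₂ : ∀ d : D, e₂ d = (d : V × V').2 := fun d => rfl
  -- transport of the actions through `e₁.symm`
  have hsymmK : ∀ (k : (uFormGroup α β).maximalCompact) (v : V),
      e₁.symm (ρK k v) = ⟨σK k (e₁.symm v : V × V'), hD.1 k _ (e₁.symm v).2⟩ := by
    intro k v
    apply e₁.injective
    rw [LinearEquiv.apply_symm_apply, he₁]
    change ρK k v = (σK k (e₁.symm v : V × V')).1
    rw [hσK]
    change ρK k v = ρK k (e₁ (e₁.symm v))
    rw [LinearEquiv.apply_symm_apply]
  have hsymm𝔤 : ∀ (X : (uFormGroup α β).lie) (v : V),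
      e₁.symm (ρ𝔤 X v) = ⟨σ𝔤 X (e₁.symm v : V × V'), hD.2 X _ (e₁.symm v).2⟩ := by
    intro X v
    apply e₁.injective
    rw [LinearEquiv.apply_symm_apply, he₁]
    change ρ𝔤 X v = (σ𝔤 X (e₁.symm v : V × V')).1
    rw [hσ𝔤]
    change ρ𝔤 X v = ρ𝔤 X (e₁ (e₁.symm v))
    rw [LinearEquiv.apply_symm_apply]
  refine ⟨{ toLinearEquiv := e₁.symm.trans e₂, map_ρK := fun k v => ?_, map_ρ𝔤 := fun X v => ?_ }⟩
  · rw [LinearEquiv.trans_apply, LinearEquiv.trans_apply, hsymmK, he₂, he₂]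
    change (σK k (e₁.symm v : V × V')).2 = _
    rw [hσK]
  · rw [LinearEquiv.trans_apply, LinearEquiv.trans_apply, hsymm𝔤, he₂, he₂]
    change (σ𝔤 X (e₁.symm v : V × V')).2 = _
    rw [hσ𝔤]

end Summit.HodgeConjecture.HodgeConjecture.Cruxes.H413.F0P3bStubT6rPNullRigidity

end
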